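import Summits.AnomalousDissipation.AnomalousDissipation.Theorems.MomentParityQuarticGateOrder3SymRealize
import Summits.AnomalousDissipation.AnomalousDissipation.Theorems.MomentParityQuarticGateOrder3SymKernel
import Summits.AnomalousDissipation.AnomalousDissipation.Theorems.MomentParityQuarticGateAssembly
import Summits.AnomalousDissipation.AnomalousDissipation.Theorems.MomentParityQuarticGateDefectPoly
import Summits.AnomalousDissipation.AnomalousDissipation.Theorems.MomentParityQuarticGateEnstrophy
import Summits.AnomalousDissipation.AnomalousDissipation.Theorems.MomentParityQuarticGateRowPoly
import Summits.AnomalousDissipation.AnomalousDissipation.Theses.MomentParity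

/-!
# Stub `stub_order3SurgerySym` (S5b) of the line `axis-sectors`
# (crux `MomentParity.QuarticGate`, stmt-AnomalousDissipation-11464)

**Order-3 surgery + Slater upgrade, Casimir-free and symmetric.** A level-`N` probability law
`μ₀` with bounded support, nondegenerate covariance on `V_N` and `H_L`-invariant cylindrical
statistics, whose linear rows vanish and whose row vanishes on every homogeneous quadratic
Casimir, for a smooth shear-invariant force, is upgraded to a level-`N` law `μ₁` with finite
fourth moments, Slater in degree `4`, 3-stationary, again `H_L`-invariant, with the same mean
energy and dissipation.

* `Order3Sym.order3SurgerySym_of` — the conditional symmetric assembly: given an orthonormal band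
  basis `b` (bundle `hb`, `hbo`, `hbs` of `exists_bandBasis`) and, AS HYPOTHESES, the row
  polynomial (I4, the shape of `exists_rowPoly`) and the dissipation polynomial (I5). Proof: `y`
  from the Casimir-free kernel step `exists_shifted_sequence_of_casimirRows` (`…Order3SymKernel`);
  `μ₁ := SYMMETRIC REALIZE(y)` (`Order3Sym.exists_symmetric_measure`, `…Order3SymRealize`), whose
  coordinate moments of degree `≤ 4` are the `H_L`-averages `|H_L|⁻¹ Σ_a L_y(Q ∘ M(a))` over the
  shear matrices `M(a)` (`…Order3SymShear`). For `a ∈ H_L`: `L_y(Q ∘ M(a)) = ∫ Q dμ₀` when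
  `deg Q ≤ 2` (`y = y₀` up to degree `2`, and the coordinate moments of the `H_L`-invariant `μ₀`
  are `M(a)`-invariant), and `L_y(Q ∘ M(a)) = 0` when `Q` is the row polynomial of a homogeneous
  quadratic test (row polynomials are closed under shear matrices, by the covariance of the
  generator under translations for a shear-invariant force). The rest is the assembly of the line
  `recession-cone` (`order3Surgery_of`).
* `stub_order3SurgerySym` — the stub, statement copied byte-for-byte from the skeleton
  `Cruxes/QuarticGate/Lines/axis-sectors.lean`: the assembly fed with `exists_bandBasis`,
  `exists_rowPoly`, `exists_gradNormSq_poly`; `order3SurgerySym` — the same statement under the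
  registered sub-goal name (the skeleton's registration of the stub is truncated).
-/

-- `Summit.<Summit>.<Problem>` is the tree's mandated summit-side namespace (CONVENTIONS §2); for this
-- single-conjunct summit the two coincide, so the duplicate is deliberate.
set_option linter.dupNamespace false

namespace Summit.AnomalousDissipation.AnomalousDissipation.Theorems.MomentParityQuarticGate

namespace Order3Sym

open scoped BigOperators InnerProductSpace RealInnerProductSpace ENNReal
open MeasureTheory MvPolynomial Literature.MeasureTheory.Moments
open Literature.Analysis.FunctionSpaces Literature.Analysis.FluidPDE
open Summit.AnomalousDissipation.AnomalousDissipation.Theorems.QuarticGate.Negative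

/-- **Order-3 surgery + Slater upgrade, Casimir-free and symmetric, conditional form.** See the
module docstring. [folklore] -/
theorem order3SurgerySym_of {N n : ℕ} {b : Fin n → UnitAddTorus (Fin 3) → EuclideanSpace ℝ (Fin 3)}
    (hb : ∀ i, IsBandTest N (b i))
    (hbo : ∀ i j, ∫ x, ⟪b i x, b j x⟫_ℝ = if i = j then (1 : ℝ) else 0)
    (hbs : ∀ u : Torus.energySpace (Fin 3), IsLevel N u →
      ∀ x, Torus.fourierTruncate N (u.1 : UnitAddTorus (Fin 3) → EuclideanSpace ℝ (Fin 3)) x =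
        ∑ i, Torus.pairing u.1 (b i) • b i x)
    (ν : ℝ) {f : UnitAddTorus (Fin 3) → EuclideanSpace ℝ (Fin 3)} (hf : Torus.IsSmooth f)
    (hfsym : ∀ a : UnitAddTorus (Fin 3), a 1 = 0 → ∀ x, f (x + a) = f x) {L : ℕ} (hL : 0 < L)
    (hRow : ∀ (m : ℕ) (g : Fin m → UnitAddTorus (Fin 3) → EuclideanSpace ℝ (Fin 3)),
      (∀ i, IsBandTest N (g i)) → ∀ (P : MvPolynomial (Fin m) ℝ) (d : ℕ), P.totalDegree ≤ d →
      ∃ Q : MvPolynomial (Fin n) ℝ, Q.totalDegree ≤ d + 1 ∧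
        (∀ u : Torus.energySpace (Fin 3), IsLevel N u →
          Torus.nsGeneratorPairing ν f u (polyGrad g P u) = eval (fun i => Torus.pairing u.1 (b i)) Q) ∧
        (∀ u : Torus.energySpace (Fin 3), IsLevel N u →
          eval (fun i => Torus.pairing u.1 (b i)) (homogeneousComponent (d + 1) Q) =
            Torus.nsGeneratorPairing (d := Fin 3) 0 0 u (polyGrad g (homogeneousComponent d P) u)))
    (hDiss : ∃ D : MvPolynomial (Fin n) ℝ, D.totalDegree ≤ 2 ∧ ∀ u : Torus.energySpace (Fin 3),
      IsLevel N u → (Torus.eGradNormSq (u.1 : UnitAddTorus (Fin 3) → EuclideanSpace ℝ (Fin 3))).toReal =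
        eval (fun i => Torus.pairing u.1 (b i)) D)
    (μ₀ : Measure (Torus.energySpace (Fin 3))) [IsProbabilityMeasure μ₀] (hl₀ : ∀ᵐ u ∂μ₀, IsLevel N u)
    (hbdd : ∃ R : ℝ, ∀ᵐ u ∂μ₀, ‖u‖ ≤ R)
    (hnd : ∀ g : UnitAddTorus (Fin 3) → EuclideanSpace ℝ (Fin 3), IsBandTest N g →
      (∃ u : Torus.energySpace (Fin 3), IsLevel N u ∧ Torus.pairing u.1 g ≠ 0) →
      (∫ u, Torus.pairing u.1 g ∂μ₀) ^ 2 < ∫ u, (Torus.pairing u.1 g) ^ 2 ∂μ₀)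
    (hsym₀ : ∀ a : UnitAddTorus (Fin 3), a 1 = 0 → L • a = 0 →
      ∀ (m : ℕ) (g : Fin m → UnitAddTorus (Fin 3) → EuclideanSpace ℝ (Fin 3)),
      (∀ i, IsBandTest N (g i)) →
      Measure.map (fun u : Torus.energySpace (Fin 3) => fun i =>
          Torus.pairing u.1 (fun x => g i (x + a))) μ₀ =
        Measure.map (fun u : Torus.energySpace (Fin 3) => fun i => Torus.pairing u.1 (g i)) μ₀)
    (hlinrow : ∀ g : UnitAddTorus (Fin 3) → EuclideanSpace ℝ (Fin 3), IsBandTest N g →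
      Integrable (fun u : Torus.energySpace (Fin 3) => Torus.nsGeneratorPairing ν f u g) μ₀ ∧
      ∫ u, Torus.nsGeneratorPairing ν f u g ∂μ₀ = 0)
    (hCas : ∀ (m : ℕ) (g : Fin m → UnitAddTorus (Fin 3) → EuclideanSpace ℝ (Fin 3))
      (P : MvPolynomial (Fin m) ℝ), (∀ i, IsBandTest N (g i)) → P.IsHomogeneous 2 →
      (∀ u : Torus.energySpace (Fin 3), IsLevel N u →
        Torus.nsGeneratorPairing (d := Fin 3) 0 0 u (polyGrad g P u) = 0) →
      ∫ u, Torus.nsGeneratorPairing ν f u (polyGrad g P u) ∂μ₀ = 0) :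
    ∃ μ₁ : Measure (Torus.energySpace (Fin 3)), IsProbabilityMeasure μ₁ ∧ (∀ᵐ u ∂μ₁, IsLevel N u) ∧
      Integrable (fun u : Torus.energySpace (Fin 3) => ‖u‖ ^ 4) μ₁ ∧
      (∀ (m : ℕ) (g : Fin m → UnitAddTorus (Fin 3) → EuclideanSpace ℝ (Fin 3))
        (P : MvPolynomial (Fin m) ℝ), (∀ i, IsBandTest N (g i)) → P.totalDegree ≤ 4 →
        (∀ u : Torus.energySpace (Fin 3), IsLevel N u →
          0 ≤ eval (fun j => Torus.pairing u.1 (g j)) P) →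
        (∃ u : Torus.energySpace (Fin 3), IsLevel N u ∧ eval (fun j => Torus.pairing u.1 (g j)) P ≠ 0) →
        0 < ∫ u, eval (fun j => Torus.pairing u.1 (g j)) P ∂μ₁) ∧
      IsPolyStationary ν f N 3 μ₁ ∧
      (∀ a : UnitAddTorus (Fin 3), a 1 = 0 → L • a = 0 →
        ∀ (m : ℕ) (g : Fin m → UnitAddTorus (Fin 3) → EuclideanSpace ℝ (Fin 3)),
        (∀ i, IsBandTest N (g i)) →
        Measure.map (fun u : Torus.energySpace (Fin 3) => fun i =>
            Torus.pairing u.1 (fun x => g i (x + a))) μ₁ =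
          Measure.map (fun u : Torus.energySpace (Fin 3) => fun i => Torus.pairing u.1 (g i)) μ₁) ∧
      Torus.ensembleEnergy μ₁ = Torus.ensembleEnergy μ₀ ∧
      Torus.ensembleDissipation ν μ₁ = Torus.ensembleDissipation ν μ₀ := by
  classical
  -- (0) coordinate calculus of the basis
  have hbsm : ∀ i, Torus.IsSmooth (b i) := fun i => (hb i).1
  have hsumband : ∀ ξ : Fin n → ℝ, IsBandTest N (fun x => ∑ i, ξ i • b i x) := fun ξ =>
    sum_smul_band Finset.univ ξ hb
  have hpb : ∀ g : UnitAddTorus (Fin 3) → EuclideanSpace ℝ (Fin 3), IsBandTest N g →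
      ∀ u : Torus.energySpace (Fin 3), Torus.pairing u.1 g =
        ∑ i, (∫ y, ⟪g y, b i y⟫_ℝ) * Torus.pairing u.1 (b i) := fun g hg u =>
    pairing_band_eq_sum hb hbs hg u
  have hgb : ∀ g : UnitAddTorus (Fin 3) → EuclideanSpace ℝ (Fin 3), IsBandTest N g →
      ∀ x, g x = ∑ i, (∫ y, ⟪g y, b i y⟫_ℝ) • b i x := fun g hg x => band_eq_sum_smul hbs hg x
  have hlev : ∀ x : Fin n → ℝ, ∃ u : Torus.energySpace (Fin 3), IsLevel N u ∧
      (fun i => Torus.pairing u.1 (b i)) = x := fun x => by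
    obtain ⟨u, hu, hux, -, -⟩ := exists_level_of_coords hb hbo x
    exact ⟨u, hu, hux⟩
  have hnorm : ∀ u : Torus.energySpace (Fin 3), IsLevel N u →
      ‖u‖ ^ 2 = ∑ i, (Torus.pairing u.1 (b i)) ^ 2 := fun u hu => norm_sq_eq_sum_sq_coords hb hbo hbs u hu
  have hlin : ∀ (u : Torus.energySpace (Fin 3)) (ξ : Fin n → ℝ),
      Torus.pairing u.1 (fun x => ∑ i, ξ i • b i x) = ∑ i, ξ i * Torus.pairing u.1 (b i) := by
    intro u ξ
    rw [hpb _ (hsumband ξ) u]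
    simp_rw [integral_inner_sum_smul_left hb hbo ξ]
  -- (1) the shear matrices and the shear group
  set M : UnitAddTorus (Fin 3) → Matrix (Fin n) (Fin n) ℝ := fun a k i => ∫ y, ⟪b k (y + a), b i y⟫_ℝ
    with hMdef
  have hM : ∀ a k i, M a k i = ∫ y, ⟪b k (y + a), b i y⟫_ℝ := fun _ _ _ => rfl
  set H : Finset (UnitAddTorus (Fin 3)) := (finite_shearGroup L hL).toFinset with hHdef
  have hHmem : ∀ a, a ∈ H ↔ a 1 = 0 ∧ L • a = 0 := fun a => by
    rw [hHdef, Set.Finite.mem_toFinset, Set.mem_setOf_eq]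
  have hH0 : (0 : UnitAddTorus (Fin 3)) ∈ H := (hHmem 0).2 ⟨rfl, smul_zero _⟩
  have hHadd : ∀ a ∈ H, ∀ a' ∈ H, a + a' ∈ H := fun a ha a' ha' =>
    (hHmem _).2 ⟨by rw [Pi.add_apply, ((hHmem a).1 ha).1, ((hHmem a').1 ha').1, add_zero],
      by rw [smul_add, ((hHmem a).1 ha).2, ((hHmem a').1 ha').2, add_zero]⟩
  have hHsub : ∀ a ∈ H, ∀ a' ∈ H, a - a' ∈ H := fun a ha a' ha' =>
    (hHmem _).2 ⟨by rw [Pi.sub_apply, ((hHmem a).1 ha).1, ((hHmem a').1 ha').1, sub_zero],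
      by rw [smul_sub, ((hHmem a).1 ha).2, ((hHmem a').1 ha').2, sub_zero]⟩
  have hcardR : (H.card : ℝ) ≠ 0 := by exact_mod_cast (Finset.card_pos.mpr ⟨0, hH0⟩).ne'
  -- (2) the target sequence and the symmetric law
  obtain ⟨y₀, y, hmom, hy0, hypos, hyeq, hrows⟩ := exists_shifted_sequence_of_casimirRows hb hsumband
    hlin hlev ν hf μ₀ hl₀ hbdd hnd (fun P hP h0 => hCas n b P hb hP h0) (fun P d hP => hRow n b hb P d hP)
  obtain ⟨μ₁, hp₁, hl₁, hi₁, hint, hsym₁⟩ :=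
    exists_symmetric_measure hb hbo hbs hM H hH0 hHadd hHsub y hy0 hypos
  -- (3) `L_y(Q ∘ M(a))` for `a ∈ H`: degree ≤ 2, and quadratic row polynomials
  have hK1 : ∀ a ∈ H, ∀ Q : MvPolynomial (Fin n) ℝ, Q.totalDegree ≤ 2 →
      rieszFunctional y (bind₁ (fun k => ∑ i, C (M a k i) * (X i : MvPolynomial (Fin n) ℝ)) Q) =
        ∫ u, eval (fun i => Torus.pairing u.1 (b i)) Q ∂μ₀ := by
    intro a ha Q hQ
    obtain ⟨ha1, haL⟩ := (hHmem a).1 ha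
    rw [rieszFunctional_congr_of_totalDegree_le (k := 2) hyeq
      ((totalDegree_bind₁_linear_le (fun k i => M a k i) Q).trans hQ), ← (hmom _).2]
    simp_rw [eval_bind₁_linear]
    exact integral_eval_shear_eq hb hbs hM μ₀ a (hsym₀ a ha1 haL n b hb) Q
  have hK2 : ∀ a ∈ H, ∀ P : MvPolynomial (Fin n) ℝ, P.IsHomogeneous 2 →
      ∀ Q : MvPolynomial (Fin n) ℝ, Q.totalDegree ≤ 3 →
      (∀ u : Torus.energySpace (Fin 3), IsLevel N u →
        Torus.nsGeneratorPairing ν f u (polyGrad b P u) = eval (fun i => Torus.pairing u.1 (b i)) Q) →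
      rieszFunctional y (bind₁ (fun k => ∑ i, C (M a k i) * (X i : MvPolynomial (Fin n) ℝ)) Q) = 0 := by
    intro a ha P hP Q hQ3 hrowQ
    obtain ⟨ha1, -⟩ := (hHmem a).1 ha
    exact hrows _ (isHomogeneous_bind₁_linear (fun k i => M a k i) hP) _
      ((totalDegree_bind₁_linear_le (fun k i => M a k i) Q).trans hQ3)
      (rowPoly_translate hb hbs hM ν a (hfsym a ha1) P Q hrowQ)
  -- averaged: moments of degree ≤ 2 of `μ₁` are those of `μ₀`
  have hlow : ∀ Q : MvPolynomial (Fin n) ℝ, Q.totalDegree ≤ 2 →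
      ∫ u, eval (fun i => Torus.pairing u.1 (b i)) Q ∂μ₁ =
        ∫ u, eval (fun i => Torus.pairing u.1 (b i)) Q ∂μ₀ := by
    intro Q hQ
    rw [(hint Q (hQ.trans (by norm_num))).2, Finset.sum_congr rfl fun a ha => hK1 a ha Q hQ,
      Finset.sum_const, nsmul_eq_mul, ← mul_assoc, inv_mul_cancel₀ hcardR, one_mul]
  -- transport data of a band test family
  have htrans : ∀ (m : ℕ) (g : Fin m → UnitAddTorus (Fin 3) → EuclideanSpace ℝ (Fin 3)),
      (∀ i, IsBandTest N (g i)) → ∀ P : MvPolynomial (Fin m) ℝ,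
      (∀ u : Torus.energySpace (Fin 3), eval (fun j => Torus.pairing u.1 (g j)) P =
        eval (fun i => Torus.pairing u.1 (b i))
          (bind₁ (fun j => ∑ i, C (∫ y, ⟪g j y, b i y⟫_ℝ) * (X i : MvPolynomial (Fin n) ℝ)) P)) ∧
      (∀ u : Torus.energySpace (Fin 3), polyGrad g P u =
        polyGrad b (bind₁ (fun j => ∑ i, C (∫ y, ⟪g j y, b i y⟫_ℝ) * (X i : MvPolynomial (Fin n) ℝ)) P) u) :=
    fun m g hg P =>
      ⟨fun u => eval_pairing_transport (fun j i => ∫ y, ⟪g j y, b i y⟫_ℝ) (fun u j => hpb _ (hg j) u) P u,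
        fun u => funext fun x => polyGrad_transport (fun j i => ∫ y, ⟪g j y, b i y⟫_ℝ)
          (fun j x => hgb _ (hg j) x) (fun u j => hpb _ (hg j) u) P u x⟩
  refine ⟨μ₁, hp₁, hl₁, hi₁, ?_, ?_, fun a ha1 haL m g hg => hsym₁ a ((hHmem a).2 ⟨ha1, haL⟩) m g hg,
    ?_, ?_⟩
  · -- SLATER in degree 4, band form
    intro m g P hg hP4 hnn hex
    obtain ⟨hev, -⟩ := htrans m g hg P
    set P' := bind₁ (fun j => ∑ i, C (∫ y, ⟪g j y, b i y⟫_ℝ) * (X i : MvPolynomial (Fin n) ℝ)) P with hP'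
    have hdeg : P'.totalDegree ≤ 4 := (totalDegree_bind₁_linear_le _ P).trans hP4
    have hnn' : ∀ x, 0 ≤ eval x P' := fun x => by
      obtain ⟨u, hu, hux⟩ := hlev x
      rw [← hux, ← hev u]
      exact hnn u hu
    have hterm : ∀ a ∈ H, 0 ≤ rieszFunctional y
        (bind₁ (fun k => ∑ i, C (M a k i) * (X i : MvPolynomial (Fin n) ℝ)) P') := fun a _ =>
      hypos.1 _ ((totalDegree_bind₁_linear_le _ P').trans hdeg) fun x _ => by
        rw [eval_bind₁_linear]; exact hnn' _
    have hzero : 0 < rieszFunctional y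
        (bind₁ (fun k => ∑ i, C (M 0 k i) * (X i : MvPolynomial (Fin n) ℝ)) P') := by
      refine hypos.2 _ ((totalDegree_bind₁_linear_le _ P').trans hdeg)
        (fun x _ => by rw [eval_bind₁_linear]; exact hnn' _) ?_
      obtain ⟨u, hu, hne⟩ := hex
      refine ⟨fun i => Torus.pairing u.1 (b i), Set.mem_univ _, ?_⟩
      rw [eval_bind₁_linear, show (fun k => ∑ i, M 0 k i * Torus.pairing u.1 (b i)) =
        fun i => Torus.pairing u.1 (b i) from by
          have h1 := shearMatrix_zero hbo hM
          funext k
          have := congr_fun (Matrix.one_mulVec (fun i => Torus.pairing u.1 (b i))) k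
          rw [← h1] at this
          exact this, ← hev u]
      exact hne
    simp_rw [hev]
    rw [(hint P' hdeg).2]
    exact mul_pos (inv_pos.mpr (by exact_mod_cast Finset.card_pos.mpr ⟨0, hH0⟩))
      (Finset.sum_pos' hterm ⟨0, hH0, hzero⟩)
  · -- 3-STATIONARITY
    intro m g P hg hP
    obtain ⟨-, hgrad⟩ := htrans m g hg P
    set P' := bind₁ (fun j => ∑ i, C (∫ y, ⟪g j y, b i y⟫_ℝ) * (X i : MvPolynomial (Fin n) ℝ)) P with hP'
    have hdeg : P'.totalDegree ≤ 2 := (totalDegree_bind₁_linear_le _ P).trans (by omega)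
    set P₂ := homogeneousComponent 2 P' with hP₂
    set P₁ := P' - homogeneousComponent 2 P' with hP₁
    have hP₂h : P₂.IsHomogeneous 2 := homogeneousComponent_isHomogeneous 2 P'
    have hP₁d : P₁.totalDegree ≤ 1 := totalDegree_sub_homogeneousComponent_two_le P' hdeg
    obtain ⟨Q₂, hQ₂deg, hQ₂row, -⟩ := hRow n b hb P₂ 2 hP₂h.totalDegree_le
    obtain ⟨Q₁, hQ₁deg, hQ₁row, -⟩ := hRow n b hb P₁ 1 hP₁d
    -- the row integrand on level-`N` fields
    have hPsplit : P' = ∑ k : Fin 2, (1 : ℝ) • (![P₂, P₁] : Fin 2 → MvPolynomial (Fin n) ℝ) k := by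
      rw [Fin.sum_univ_two]
      simp [hP₂, hP₁]
    have hsplit : ∀ u : Torus.energySpace (Fin 3), IsLevel N u →
        Torus.nsGeneratorPairing ν f u (polyGrad g P u) =
          eval (fun i => Torus.pairing u.1 (b i)) (Q₂ + Q₁) := fun u hu => by
      rw [hgrad u, hPsplit, nsGeneratorPairing_polyGrad_sum_smul ν hf hbsm, Fin.sum_univ_two, map_add]
      simp [hQ₂row u hu, hQ₁row u hu]
    have hQdeg : (Q₂ + Q₁).totalDegree ≤ 4 :=
      (totalDegree_add _ _).trans (max_le (hQ₂deg.trans (by norm_num)) (hQ₁deg.trans (by norm_num)))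
    refine ⟨(hint _ hQdeg).1.congr (hl₁.mono fun u hu => (hsplit u hu).symm), ?_⟩
    -- the row of the degree-`≤ 1` part under `μ₀`: a fixed band field
    have hQ₁int : ∫ u, eval (fun i => Torus.pairing u.1 (b i)) Q₁ ∂μ₀ = 0 := by
      rw [← integral_congr_ae (hl₀.mono fun u hu => hQ₁row u hu)]
      have hw : ∀ u : Torus.energySpace (Fin 3), polyGrad b P₁ u =
          fun x => ∑ i, P₁.coeff (Finsupp.single i 1) • b i x := fun u => by
        funext x
        unfold polyGrad
        simp_rw [pderiv_eq_C_of_totalDegree_le_one P₁ hP₁d, eval_C]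
      simp_rw [hw]
      exact (hlinrow _ (hsumband _)).2
    rw [integral_congr_ae (hl₁.mono fun u hu => hsplit u hu), (hint _ hQdeg).2]
    refine mul_eq_zero_of_right _ (Finset.sum_eq_zero fun a ha => ?_)
    rw [map_add, rieszFunctional_add, hK2 a ha P₂ hP₂h Q₂ hQ₂deg hQ₂row, zero_add,
      hK1 a ha Q₁ (hQ₁deg.trans (by norm_num)), hQ₁int]
  · -- ENERGY
    have hev : ∀ u : Torus.energySpace (Fin 3), IsLevel N u →
        ‖u‖ ^ 2 = eval (fun i => Torus.pairing u.1 (b i)) (∑ i, (X i : MvPolynomial (Fin n) ℝ) ^ 2) :=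
      fun u hu => by rw [hnorm u hu]; simp [map_sum]
    unfold Torus.ensembleEnergy
    rw [integral_congr_ae (hl₁.mono fun u hu => hev u hu), integral_congr_ae (hl₀.mono fun u hu => hev u hu)]
    exact hlow _ (totalDegree_sum_X_sq_le n)
  · -- DISSIPATION
    obtain ⟨D, hDdeg, hD⟩ := hDiss
    unfold Torus.ensembleDissipation Torus.ensembleEnstrophy
    rw [toReal_lintegral_eGradNormSq_eq D hD μ₁ hl₁ (hint D (hDdeg.trans (by norm_num))).1,
      toReal_lintegral_eGradNormSq_eq D hD μ₀ hl₀ (hmom D).1, hlow D hDdeg]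

end Order3Sym

open MeasureTheory Filter
open Literature.Analysis.FunctionSpaces Literature.Analysis.FluidPDE
open Summit.AnomalousDissipation.AnomalousDissipation.Theses.MomentParity
open Summit.AnomalousDissipation.AnomalousDissipation.Theorems.QuarticGate.Negative

/-- **S5b — ORDER-3 SURGERY + SLATER UPGRADE, CASIMIR-FREE AND SYMMETRIC (the lead's S5 with its
Casimir hypothesis replaced by what its kernel step consumes, and the symmetry carried through).**
A level-`N` probability law `μ₀` with bounded support, NONDEGENERATE covariance on `V_N` and
`H_L`-invariant cylindrical statistics, whose LINEAR rows vanish and whose row vanishes on EVERY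
homogeneous quadratic Casimir (S5a's conclusion), for a smooth `G′`-invariant force ⟹ a level-`N` law
`μ₁` with finite fourth moments, Slater at degree 4, 3-STATIONARY, again `H_L`-invariant, with the same
mean energy and dissipation.
Why true: exactly the lead's pipeline (Rows → Fatten → QuadRange → Kernel → LambdaPositivity →
Realize → Assembly, all landed as `--supports`): the quadratic-row vector `a` kills `ker cᵀ` =
quadratic Casimirs in band coordinates BY HYPOTHESIS (this is the only place the lead used
QuadRigidity + the `E`/`H` rows), so `a = c s`, the shift `S = −s` of `M₃` kills every quadratic row,
`y_Λ = (1, M₁, M₂, M₃ + S, Λ M₄^{fat})` is strictly positive for `Λ ≫ 1`, REALIZE it (Fialkow–Nie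
Thm 1.3, PROVED: `FialkowNie2010_thm_1_3_holds`; with a density / enough generic atoms, cdisprove §G
remark). SYMMETRY: replace the realised atoms `xᵢ` (band coordinates) by their `H_L`-orbits `ρ(a)xᵢ`
(`exists_level_of_coords`): the moment vector becomes the `H_L`-average `ȳ_Λ`, which still kills every
row of degree `≤ 2` (rows of translated tests, `f` invariant), is still strictly positive (convexity),
and agrees with `y_Λ` up to degree 2 (`μ₀` is `H_L`-invariant) — so energy, dissipation, linear rows
are unchanged and `LawSym N L μ₁` holds. Size L–XL (the lead's S5, ≈ landed) + M (symmetrisation).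
[folklore] -/
theorem stub_order3SurgerySym :
    ∀ (ν : ℝ) (f : UnitAddTorus (Fin 3) → EuclideanSpace ℝ (Fin 3)) (N L : ℕ)
      (μ₀ : Measure (Torus.energySpace (Fin 3))),
    Torus.IsSmooth f → (∀ a : UnitAddTorus (Fin 3), a 1 = 0 → ∀ x, f (x + a) = f x) → 0 < L →
    IsProbabilityMeasure μ₀ → (∀ᵐ u ∂μ₀, IsLevel N u) → (∃ R : ℝ, ∀ᵐ u ∂μ₀, ‖u‖ ≤ R) →
    (∀ g : UnitAddTorus (Fin 3) → EuclideanSpace ℝ (Fin 3), IsBandTest N g →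
      (∃ u : Torus.energySpace (Fin 3), IsLevel N u ∧ Torus.pairing u.1 g ≠ 0) →
      (∫ u : Torus.energySpace (Fin 3), Torus.pairing u.1 g ∂μ₀) ^ 2 <
        ∫ u : Torus.energySpace (Fin 3), (Torus.pairing u.1 g) ^ 2 ∂μ₀) →
    (∀ a : UnitAddTorus (Fin 3), a 1 = 0 → L • a = 0 →
      ∀ (m : ℕ) (g : Fin m → UnitAddTorus (Fin 3) → EuclideanSpace ℝ (Fin 3)),
      (∀ i, IsBandTest N (g i)) →
      Measure.map (fun u : Torus.energySpace (Fin 3) => fun i => Torus.pairing u.1 (fun x => g i (x + a))) μ₀ =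
        Measure.map (fun u : Torus.energySpace (Fin 3) => fun i => Torus.pairing u.1 (g i)) μ₀) →
    (∀ g : UnitAddTorus (Fin 3) → EuclideanSpace ℝ (Fin 3), IsBandTest N g →
      Integrable (fun u : Torus.energySpace (Fin 3) => Torus.nsGeneratorPairing ν f u g) μ₀ ∧
      ∫ u : Torus.energySpace (Fin 3), Torus.nsGeneratorPairing ν f u g ∂μ₀ = 0) →
    (∀ (m : ℕ) (g : Fin m → UnitAddTorus (Fin 3) → EuclideanSpace ℝ (Fin 3))
      (P : MvPolynomial (Fin m) ℝ), (∀ i, IsBandTest N (g i)) → P.IsHomogeneous 2 →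
      (∀ u : Torus.energySpace (Fin 3), IsLevel N u →
        Torus.nsGeneratorPairing (d := Fin 3) 0 0 u (polyGrad g P u) = 0) →
      ∫ u, Torus.nsGeneratorPairing ν f u (polyGrad g P u) ∂μ₀ = 0) →
    ∃ μ₁ : Measure (Torus.energySpace (Fin 3)), IsProbabilityMeasure μ₁ ∧ (∀ᵐ u ∂μ₁, IsLevel N u) ∧
      Integrable (fun u : Torus.energySpace (Fin 3) => ‖u‖ ^ 4) μ₁ ∧
      (∀ (m : ℕ) (g : Fin m → UnitAddTorus (Fin 3) → EuclideanSpace ℝ (Fin 3))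
        (P : MvPolynomial (Fin m) ℝ), (∀ i, IsBandTest N (g i)) → P.totalDegree ≤ 4 →
        (∀ u : Torus.energySpace (Fin 3), IsLevel N u →
          0 ≤ MvPolynomial.eval (fun j => Torus.pairing u.1 (g j)) P) →
        (∃ u : Torus.energySpace (Fin 3), IsLevel N u ∧
          MvPolynomial.eval (fun j => Torus.pairing u.1 (g j)) P ≠ 0) →
        0 < ∫ u, MvPolynomial.eval (fun j => Torus.pairing u.1 (g j)) P ∂μ₁) ∧
      IsPolyStationary ν f N 3 μ₁ ∧
      (∀ a : UnitAddTorus (Fin 3), a 1 = 0 → L • a = 0 →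
        ∀ (m : ℕ) (g : Fin m → UnitAddTorus (Fin 3) → EuclideanSpace ℝ (Fin 3)),
        (∀ i, IsBandTest N (g i)) →
        Measure.map (fun u : Torus.energySpace (Fin 3) => fun i => Torus.pairing u.1 (fun x => g i (x + a))) μ₁ =
          Measure.map (fun u : Torus.energySpace (Fin 3) => fun i => Torus.pairing u.1 (g i)) μ₁) ∧
      Torus.ensembleEnergy μ₁ = Torus.ensembleEnergy μ₀ ∧
      Torus.ensembleDissipation ν μ₁ = Torus.ensembleDissipation ν μ₀ := by
  intro ν f N L μ₀ hf hfsym hL hp₀ hl₀ hR₀ hnd₀ hsym₀ hlin₀ hCas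
  obtain ⟨n, b, hb, hbo, hbs⟩ := exists_bandBasis N
  haveI := hp₀
  have hbsm : ∀ i, Torus.IsSmooth (b i) := fun i => (hb i).1
  obtain ⟨D, hDdeg, hD⟩ := exists_gradNormSq_poly hbsm
  exact Order3Sym.order3SurgerySym_of hb hbo hbs ν hf hfsym hL
    (fun m g hg P d hP => exists_rowPoly hb hbo hbs ν f hf m g hg P d hP)
    ⟨D, hDdeg, fun u hu => hD _ _ (coe_ae_eq_sum_of_level hbs u hu)⟩
    μ₀ hl₀ hR₀ hnd₀ hsym₀ hlin₀ hCas


/-- **Registered sub-goal `order3SurgerySym` of stmt-AnomalousDissipation-11464** (= `stub_order3SurgerySym` above, same statement; the skeleton's own registration of `stub_order3SurgerySym` is truncated at its first `:=` and cannot be matched by the gate). [folklore] -/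
theorem order3SurgerySym : ∀ (ν : ℝ) (f : UnitAddTorus (Fin 3) → EuclideanSpace ℝ (Fin 3)) (N L : ℕ) (μ₀ : Measure (Torus.energySpace (Fin 3))), Torus.IsSmooth f → (∀ a : UnitAddTorus (Fin 3), a 1 = 0 → ∀ x, f (x + a) = f x) → 0 < L → IsProbabilityMeasure μ₀ → (∀ᵐ u ∂μ₀, IsLevel N u) → (∃ R : ℝ, ∀ᵐ u ∂μ₀, ‖u‖ ≤ R) → (∀ g : UnitAddTorus (Fin 3) → EuclideanSpace ℝ (Fin 3), IsBandTest N g → (∃ u : Torus.energySpace (Fin 3), IsLevel N u ∧ Torus.pairing u.1 g ≠ 0) → (∫ u : Torus.energySpace (Fin 3), Torus.pairing u.1 g ∂μ₀) ^ 2 < ∫ u : Torus.energySpace (Fin 3), (Torus.pairing u.1 g) ^ 2 ∂μ₀) → (∀ a : UnitAddTorus (Fin 3), a 1 = 0 → L • a = 0 → ∀ (m : ℕ) (g : Fin m → UnitAddTorus (Fin 3) → EuclideanSpace ℝ (Fin 3)), (∀ i, IsBandTest N (g i)) → Measure.map (fun u : Torus.energySpace (Fin 3) => fun i => Torus.pairing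 u.1 (fun x => g i (x + a))) μ₀ = Measure.map (fun u : Torus.energySpace (Fin 3) => fun i => Torus.pairing u.1 (g i)) μ₀) → (∀ g : UnitAddTorus (Fin 3) → EuclideanSpace ℝ (Fin 3), IsBandTest N g → Integrable (fun u : Torus.energySpace (Fin 3) => Torus.nsGeneratorPairing ν f u g) μ₀ ∧ ∫ u : Torus.energySpace (Fin 3), Torus.nsGeneratorPairing ν f u g ∂μ₀ = 0) → (∀ (m : ℕ) (g : Fin m → UnitAddTorus (Fin 3) → EuclideanSpace ℝ (Fin 3)) (P : MvPolynomial (Fin m) ℝ), (∀ i, IsBandTest N (g i)) → P.IsHomogeneous 2 → (∀ u : Torus.energySpace (Fin 3), IsLevel N u → Torus.nsGeneratorPairing (d := Fin 3) 0 0 u (polyGrad g P u) = 0) → ∫ u, Torus.nsGeneratorPairing ν f u (polyGrad g P u) ∂μ₀ = 0) → ∃ μ₁ : Measure (Torus.energySpace (Fin 3)), IsProbabilityMeasure μ₁ ∧ (∀ᵐ u ∂μ₁, IsLevel N u) ∧ Integrable (fun u : Torus.energySpace (Fin 3) => ‖u‖ ^ 4) μ₁ ∧ (∀ (m : ℕ)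 (g : Fin m → UnitAddTorus (Fin 3) → EuclideanSpace ℝ (Fin 3)) (P : MvPolynomial (Fin m) ℝ), (∀ i, IsBandTest N (g i)) → P.totalDegree ≤ 4 → (∀ u : Torus.energySpace (Fin 3), IsLevel N u → 0 ≤ MvPolynomial.eval (fun j => Torus.pairing u.1 (g j)) P) → (∃ u : Torus.energySpace (Fin 3), IsLevel N u ∧ MvPolynomial.eval (fun j => Torus.pairing u.1 (g j)) P ≠ 0) → 0 < ∫ u, MvPolynomial.eval (fun j => Torus.pairing u.1 (g j)) P ∂μ₁) ∧ IsPolyStationary ν f N 3 μ₁ ∧ (∀ a : UnitAddTorus (Fin 3), a 1 = 0 → L • a = 0 → ∀ (m : ℕ) (g : Fin m → UnitAddTorus (Fin 3) → EuclideanSpace ℝ (Fin 3)), (∀ i, IsBandTest N (g i)) → Measure.map (fun u : Torus.energySpace (Fin 3) => fun i => Torus.pairing u.1 (fun x => g i (x + a))) μ₁ = Measure.map (fun u : Torus.energySpace (Fin 3) => fun i => Torus.pairing u.1 (g i)) μ₁) ∧ Torus.ensembleEnergy μ₁ = Torus.ensembleEnergy μ₀ ∧ Torus.ensembleDissipation ν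 μ₁ = Torus.ensembleDissipation ν μ₀ :=
  stub_order3SurgerySym

end Summit.AnomalousDissipation.AnomalousDissipation.Theorems.MomentParityQuarticGate
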